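import Literature.Dynamics.TopologicalDynamics.KrylovBogolyubov
import Mathlib.Dynamics.Ergodic.Extreme
import Mathlib.Analysis.Convex.KreinMilman
import Mathlib.MeasureTheory.Measure.Prokhorov
import Mathlib.Topology.Algebra.Module.LocallyConvex
import HarnessLib

/-!
# Crux `RecurrentLiouville` (stmt-NavierStokesRegularity-1589), line `Sketch` v10 — stub SM1:
# ERGODIC invariant probability measures exist (ergodic Krylov–Bogolyubov theorem)

`stub_smErgodicMeasure`: a continuous self-map `f` of a nonempty compact Hausdorff space `X` in
which indicators of closed sets are decreasing limits of bounded continuous functions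
(`HasOuterApproxClosed X`, e.g. a compact metrisable space) preserves some ERGODIC Borel
probability measure.  This is the textbook fact "the ergodic measures are the extreme points of the
weak-* compact convex set of invariant probability measures, which has extreme points by the
Krein–Milman theorem" (Einsiedler–Ward 2017, Prop. 8.36 with Thm. 8.80; Brin–Stuck 2002,
Prop. 4.6.2); Mathlib (2026-08) has the direction "extreme point ⇒ ergodic"
(`Ergodic.of_mem_extremePoints`, for `ℝ≥0∞`-segments in `Measure X`) and the Krein–Milman lemma
(`IsCompact.extremePoints_nonempty`, real locally convex spaces) but not the existence statement.

**Proof.**  Let `S ⊆ ProbabilityMeasure X` be the set of probability measures `ν` with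
`∫ g ∘ f dν = ∫ g dν` for every `g : X →ᵇ ℝ`; by `measurePreserving_of_forall_integral_comp_eq`
(tree, Krylov–Bogolyubov file) these are exactly the `f`-invariant ones, `S` is nonempty by the
Krylov–Bogolyubov theorem (`exists_measurePreserving_of_continuous`) and closed in the compact space
`ProbabilityMeasure X` (`instCompactSpaceProbabilityMeasure`, topology of weak convergence), the
conditions being equalities of continuous functionals.  The map `T ν = (g ↦ ∫ g dν)` into the real
locally convex Hausdorff space `(X →ᵇ ℝ) → ℝ` (product topology) is continuous, so `T '' S` is a
nonempty compact set and has an extreme point `T ν₀`, `ν₀ ∈ S` (Krein–Milman lemma; no convexity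
is needed).  If `ν₀ = a • ν₁ + b • ν₂` with invariant probability measures `νᵢ` and
`a, b ∈ ℝ≥0∞`, `0 < a, b`, `a + b = 1`, then `T ν₀ = a.toReal • T ν₁ + b.toReal • T ν₂` lies on the
real open segment from `T ν₁` to `T ν₂`, so `T ν₁ = T ν₀` by extremality, i.e. `ν₁` and `ν₀`
integrate every bounded continuous function alike, whence `ν₁ = ν₀`
(`ext_of_forall_integral_eq_of_IsFiniteMeasure`).  Thus `ν₀` is an `ℝ≥0∞`-extreme point of the
set of invariant probability measures, hence ergodic (`Ergodic.of_mem_extremePoints`).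

## References

* M. Einsiedler, T. Ward, *Functional Analysis, Spectral Theory, and Applications*, GTM 276,
  Springer (2017), Prop. 8.36, Thm. 8.80, §8.6.1. [EinsiedlerWard2017]
* M. Brin, G. Stuck, *Introduction to Dynamical Systems*, CUP (2002), Prop. 4.6.2.
-/

noncomputable section

-- the sub-problem namespace repeats the summit name (D-0017 layout `Summit.<S>.<P>.Theorems`)
set_option linter.dupNamespace false

namespace Summit.NavierStokesRegularity.NavierStokesRegularity.Theorems

open MeasureTheory Set Function Filter Topology
open Literature.Dynamics.TopologicalDynamics
open scoped NNReal ENNReal BoundedContinuousFunction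

/-- A measure-preserving map preserves the integrals of bounded continuous functions:
`∫ g ∘ f dν = ∫ g dν`. [folklore] -/
theorem smEM_integral_comp_eq_of_measurePreserving {X : Type*} [TopologicalSpace X]
    [MeasurableSpace X] [OpensMeasurableSpace X] {ν : Measure X} {f : X → X}
    (hν : MeasurePreserving f ν ν) (g : X →ᵇ ℝ) :
    ∫ x, g (f x) ∂ν = ∫ x, g x ∂ν := by
  rw [← integral_map hν.measurable.aemeasurable g.continuous.aestronglyMeasurable, hν.map_eq]

/-- The set of probability measures `ν` with `∫ g ∘ f dν = ∫ g dν` for all bounded continuous `g`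
(for `f` continuous) is closed in the topology of weak convergence. [folklore] -/
theorem smEM_isClosed_setOf_forall_integral_comp_eq {X : Type*} [TopologicalSpace X]
    [MeasurableSpace X] [OpensMeasurableSpace X] {f : X → X} (hf : Continuous f) :
    IsClosed {ν : ProbabilityMeasure X |
      ∀ g : X →ᵇ ℝ, ∫ x, g (f x) ∂(ν : Measure X) = ∫ x, g x ∂(ν : Measure X)} := by
  have e : {ν : ProbabilityMeasure X |
      ∀ g : X →ᵇ ℝ, ∫ x, g (f x) ∂(ν : Measure X) = ∫ x, g x ∂(ν : Measure X)} =
      ⋂ g : X →ᵇ ℝ, {ρ : ProbabilityMeasure X |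
        ∫ x, (g.compContinuous ⟨f, hf⟩) x ∂(ρ : Measure X) = ∫ x, g x ∂(ρ : Measure X)} := by
    ext ρ
    simp only [mem_setOf_eq, mem_iInter, BoundedContinuousFunction.compContinuous_apply,
      ContinuousMap.coe_mk]
  rw [e]
  exact isClosed_iInter fun g => isClosed_eq
    (ProbabilityMeasure.continuous_integral_boundedContinuousFunction _)
    (ProbabilityMeasure.continuous_integral_boundedContinuousFunction _)

/-- The integral of a bounded continuous function against an `ℝ≥0∞`-convex combination
`a • ν₁ + b • ν₂` (`a, b ≠ ∞`) of finite measures is the corresponding real convex combination of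
the integrals. [folklore] -/
theorem smEM_integral_add_smul_measure {X : Type*} [TopologicalSpace X] [MeasurableSpace X]
    [OpensMeasurableSpace X] {ν₁ ν₂ : Measure X} [IsFiniteMeasure ν₁] [IsFiniteMeasure ν₂]
    {a b : ℝ≥0∞} (ha : a ≠ ∞) (hb : b ≠ ∞) (g : X →ᵇ ℝ) :
    ∫ x, g x ∂(a • ν₁ + b • ν₂) = a.toReal * ∫ x, g x ∂ν₁ + b.toReal * ∫ x, g x ∂ν₂ := by
  rw [integral_add_measure ((g.integrable ν₁).smul_measure ha) ((g.integrable ν₂).smul_measure hb),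
    integral_smul_measure, integral_smul_measure, smul_eq_mul, smul_eq_mul]

/-- **SM1, ergodic invariant measures exist** (Einsiedler–Ward 2017, Prop. 8.36 with the
Krein–Milman theorem 8.80; Brin–Stuck 2002, Prop. 4.6.2 and the remark after it): a continuous
self-map of a nonempty compact Hausdorff space in which indicators of closed sets are decreasing
limits of bounded continuous functions (e.g. a compact metrisable space) preserves some ERGODIC Borel
probability measure.  Proof: the invariant probability measures, tested on bounded continuous
functions, form a nonempty (tree Krylov–Bogolyubov `exists_measurePreserving_of_continuous`) closed
subset of the compact space `ProbabilityMeasure X`; its image under the continuous map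
`μ ↦ (g ↦ ∫ g dμ)` in the locally convex space `(X →ᵇ ℝ) → ℝ` has an extreme point
(`IsCompact.extremePoints_nonempty`), which pulls back to an `ℝ≥0∞`-extreme point of the set of
invariant probability measures (measures are determined by the integrals of bounded continuous
functions), hence to an ergodic measure (`Ergodic.of_mem_extremePoints`).
[cite: EinsiedlerWard2017, Prop. 8.36, Thm. 8.80] -/
theorem stub_smErgodicMeasure {X : Type*} [TopologicalSpace X] [MeasurableSpace X] [BorelSpace X]
    [CompactSpace X] [T2Space X] [HasOuterApproxClosed X] [Nonempty X]
    {f : X → X} (hf : Continuous f) :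
    ∃ μ : Measure X, IsProbabilityMeasure μ ∧ Ergodic f μ := by
  classical
  have hfm : Measurable f := hf.measurable
  -- the evaluation map into the real locally convex Hausdorff space `(X →ᵇ ℝ) → ℝ`
  obtain ⟨T, hT⟩ : ∃ T : ProbabilityMeasure X → ((X →ᵇ ℝ) → ℝ),
      ∀ ν g, T ν g = ∫ x, g x ∂(ν : Measure X) := ⟨fun ν g => ∫ x, g x ∂(ν : Measure X), fun _ _ => rfl⟩
  have hTc : Continuous T := by
    refine continuous_pi fun g => ?_
    have e : (fun ν => T ν g) = fun ν : ProbabilityMeasure X => ∫ x, g x ∂(ν : Measure X) :=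
      funext fun ν => hT ν g
    rw [e]
    exact ProbabilityMeasure.continuous_integral_boundedContinuousFunction g
  -- invariance tested on bounded continuous functions
  set S : Set (ProbabilityMeasure X) := {ν : ProbabilityMeasure X |
    ∀ g : X →ᵇ ℝ, ∫ x, g (f x) ∂(ν : Measure X) = ∫ x, g x ∂(ν : Measure X)} with hS
  have hSclosed : IsClosed S := smEM_isClosed_setOf_forall_integral_comp_eq hf
  have hS_of : ∀ ν : ProbabilityMeasure X,
      MeasurePreserving f (ν : Measure X) (ν : Measure X) → ν ∈ S :=
    fun ν hν g => smEM_integral_comp_eq_of_measurePreserving hν g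
  have hof_S : ∀ ν : ProbabilityMeasure X, ν ∈ S →
      MeasurePreserving f (ν : Measure X) (ν : Measure X) :=
    fun ν hν => measurePreserving_of_forall_integral_comp_eq hfm hν
  -- `T '' S` is a nonempty compact set, so it has an extreme point (Krein–Milman lemma)
  have hKc : IsCompact (T '' S) := hSclosed.isCompact.image hTc
  obtain ⟨μ₀, hμ₀P, hμ₀⟩ := exists_measurePreserving_of_continuous hf
  have hKne : (T '' S).Nonempty :=
    ⟨T ⟨μ₀, hμ₀P⟩, mem_image_of_mem T (hS_of ⟨μ₀, hμ₀P⟩ hμ₀)⟩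
  obtain ⟨w, hw⟩ := hKc.extremePoints_nonempty hKne
  obtain ⟨ν₀, hν₀S, hν₀w⟩ := hw.1
  refine ⟨(ν₀ : Measure X), inferInstance, Ergodic.of_mem_extremePoints ?_⟩
  -- `ν₀` is an `ℝ≥0∞`-extreme point of the invariant probability measures
  rw [mem_extremePoints_iff_left]
  refine ⟨⟨hof_S ν₀ hν₀S, inferInstance⟩, ?_⟩
  rintro ν₁ ⟨hν₁f, hν₁P⟩ ν₂ ⟨hν₂f, hν₂P⟩ ⟨a, b, ha, hb, hab, he⟩
  haveI := hν₁P
  haveI := hν₂P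
  have ha1 : a ≤ 1 := by
    calc a ≤ a + b := le_self_add
      _ = 1 := hab
  have hb1 : b ≤ 1 := by
    calc b ≤ a + b := le_add_self
      _ = 1 := hab
  have hat : a ≠ ∞ := ne_top_of_le_ne_top ENNReal.one_ne_top ha1
  have hbt : b ≠ ∞ := ne_top_of_le_ne_top ENNReal.one_ne_top hb1
  have h₁S : (⟨ν₁, hν₁P⟩ : ProbabilityMeasure X) ∈ S := hS_of ⟨ν₁, hν₁P⟩ hν₁f
  have h₂S : (⟨ν₂, hν₂P⟩ : ProbabilityMeasure X) ∈ S := hS_of ⟨ν₂, hν₂P⟩ hν₂f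
  -- `T ν₀` lies on the real open segment from `T ν₁` to `T ν₂`
  have hTe : a.toReal • T ⟨ν₁, hν₁P⟩ + b.toReal • T ⟨ν₂, hν₂P⟩ = T ν₀ := by
    funext g
    simp only [Pi.add_apply, Pi.smul_apply, smul_eq_mul, hT, ProbabilityMeasure.coe_mk]
    rw [← he, smEM_integral_add_smul_measure hat hbt g]
  have hseg : T ν₀ ∈ openSegment ℝ (T ⟨ν₁, hν₁P⟩) (T ⟨ν₂, hν₂P⟩) := by
    refine ⟨a.toReal, b.toReal, ENNReal.toReal_pos ha.ne' hat, ENNReal.toReal_pos hb.ne' hbt,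
      ?_, hTe⟩
    rw [← ENNReal.toReal_add hat hbt, hab, ENNReal.toReal_one]
  -- extremality of `T ν₀ = w` in `T '' S`
  have hT₁ : T ⟨ν₁, hν₁P⟩ = T ν₀ := by
    have h := hw.2 (mem_image_of_mem T h₁S) (mem_image_of_mem T h₂S) (hν₀w ▸ hseg)
    rw [h, hν₀w]
  -- measures are determined by the integrals of bounded continuous functions
  refine ext_of_forall_integral_eq_of_IsFiniteMeasure fun g => ?_
  have h := congr_fun hT₁ g
  simpa only [hT, ProbabilityMeasure.coe_mk] using h

end Summit.NavierStokesRegularity.NavierStokesRegularity.Theorems
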